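import Literature.NumberTheory.EllipticCurves.ZpExtensionEisensteinTwistRestrictedDualityInstanceProofs
import Literature.NumberTheory.GaloisCohomology.Howard2004.DualityDatumRestrictedPairingProofs
import Literature.NumberTheory.EllipticCurves.ZpExtensionEisensteinDVRSetting
import Literature.NumberTheory.EllipticCurves.TorsionFilAtConjugatePairingMultiplicativeThreeProofs
import HarnessLib

/-!
# H.4 at a place `v ∣ 3` of MULTIPLICATIVE reduction: the restricted local pairing of the curve's Eisenstein tower exists and is
# non-degenerate (theorems only — no definition, no named fact, no instance, no `sorry`)

Topic `NumberTheory/EllipticCurves` (LEAD `bsd-wall-utd-p1`, crux r205 stmt-BirchSwinnertonDyer-24737 `TwinAlgMuZeroAtThree`,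
line `beta-road`, stub `stub_howardOutputsOfFamily`, E2 assembly at `v ∣ 3`).  Cell x9's
`ZpExtensionEisensteinDVRSettingH4RestrictedPairingProofs.eisensteinTower_restrictedPairing_nondegenerate` takes
`hordW : IsOrdinaryAt W p` (good ORDINARY reduction of `E/ℚ` at `p`), used only through the perfectness lemma
`eisensteinDualityForm_torsionFilAt_restricted_perfect_of_isOrdinaryAt`.  For the twin `W′` (`3 ∥ N′`, multiplicative at `3`) the
perfectness holds by `TorsionFilAtConjugatePairingMultiplicativeThreeProofs`; this file is x9's statement and proof at `p = 3` with
`hordW` replaced by `hmult : (W.baseChange K).HasMultiplicativeReductionAt v`.  BSD is not proved by any of this.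

References: [Howard2004HeegnerKolyvagin] §1.3 H.4, Lemma 2.1.1, §3.1, Lemma 3.1.1; [MilneADT2006] I Cor. 2.3; [GreenbergLNM1716] §2.
-/

set_option autoImplicit false

noncomputable section

open scoped TensorProduct ContRepresentation NumberField
open Function NumberField IsDedekindDomain Field

namespace WeierstrassCurve

open Literature.NumberTheory.EllipticCurves Literature.NumberTheory.GaloisRepresentations
open Literature.NumberTheory.GaloisRepresentations.DiscreteGaloisModule
open Literature.NumberTheory.GaloisCohomology.Howard2004 Literature.NumberTheory.EllipticCurves.IwasawaAlgebra
open Literature.NumberTheory.EllipticCurves.ZpExtension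

variable {K : Type} [Field K] [NumberField K] (W : WeierstrassCurve ℚ) [W.IsElliptic]
  (κ : ZpExtension K 3) {m : ℕ} (hm : 1 ≤ m)
  (σ : K ≃ₐ[ℚ] K) (hσ₁ : σ ≠ 1) (hσ : σ * σ = 1) (τ : AlgebraicClosure K ≃+* AlgebraicClosure K)
  (hτ : IsLiftOfAut σ τ) (hτ₂ : Function.Involutive τ)

/-- **The restricted local pairing of H.4 at `v ∣ p` for the curve's Eisenstein tower exists and is non-degenerate on both sides**
(TURNKEY for the (Exact)-at-`p` descent): see the module docstring.  `V`/`V′` are the plus part at `v` and the `δ_v`-transport of the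
plus part at `σ v` of the level `W_{k+1} = κ.eisensteinTwist E_K[p^{k+1}] hm (k+1)` (`= (W.eisensteinTower κ hm).ρ k`, `rfl`), given by
their defining equations `hVdef`/`hV'def` (pass `rfl`) for ANY presentation `t, ht` of the transitions (the plus parts only see
`Fil_v E[p^{k+1}]`), with their stability proofs `hV`, `hV′` supplied by the caller (`OrdinaryFiltration.twistedFil_le_comap`,
`ConjugationDatum.map_delta_le_comap_twist`).
[cite: Howard2004HeegnerKolyvagin, §1.3 H.4, Lemma 3.1.1 and Def. 3.2.6 (arXiv:1202.6340 p. 7 L78–82, p. 15 L60–62, p. 16 L108–110)]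
[cite: MilneADT2006, I Cor. 2.3] [cite: SerreGaloisCohomology1997, II §5.2 Thm. 2] -/
theorem eisensteinTower_restrictedPairing_nondegenerate_of_hasMultiplicativeReductionAt_three (v : HeightOneSpectrum (𝓞 K))
    (hmult : (W.baseChange K).HasMultiplicativeReductionAt v)
    (hpv : ((3 : ℕ) : 𝓞 K) ∈ v.asIdeal) [CharZero (v.adicCompletion K)] (k : ℕ)
    (t : ∀ j, ((W.baseChange K).torsionGaloisModule (((3 : ℕ) : ℤ) ^ (j + 1))).toContRepresentation →ⁱL
      ((W.baseChange K).torsionGaloisModule (((3 : ℕ) : ℤ) ^ j)).toContRepresentation)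
    (ht : ∀ j (P : geomTorsion (W.baseChange K) (((3 : ℕ) : ℤ) ^ (j + 1))), t j P = (W.baseChange K).geomTorsionReduce 3 j P)
    (D : DualityDatum 3 (ConjugationDatum.ofLifts σ hσ₁ hσ τ hτ hτ₂)
      (κ.eisensteinTwist ((W.baseChange K).torsionGaloisModule (((3 : ℕ) : ℤ) ^ (k + 1))) hm (k + 1))
      (EisensteinCoeff 3 m (k + 1)))
    (e : geomTorsion (W.baseChange K) (((3 : ℕ) : ℤ) ^ (k + 1)) →+ geomTorsion (W.baseChange K) (((3 : ℕ) : ℤ) ^ (k + 1)) →+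
      MuCarrier K (3 ^ (k + 1)))
    (log : MuCarrier K (3 ^ (k + 1)) →+ ZMod (3 ^ (k + 1)))
    (hDe : D.e = eisensteinDualityForm hm (k + 1) (conjPairing e (hτ.torsionMap W (((3 : ℕ) : ℤ) ^ (k + 1))) log))
    (halt : ∀ a, e a a = 0) (hnd : ∀ b, (∀ a, e a b = 0) → b = 0)
    (hθθ : ∀ a : geomTorsion (W.baseChange K) (((3 : ℕ) : ℤ) ^ (k + 1)), hτ.torsionMap W _ (hτ.torsionMap W _ a) = a)
    (hlog : Bijective log)
    (hlogχ : ∀ (g : absoluteGaloisGroup K) ξ, log (mu K (3 ^ (k + 1)) g ξ) = cyclotomicCharacterModPow K 3 (k + 1) g * log ξ)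
    (V V' : Submodule ℤ (EisensteinCoeff.Twisted 3 m (k + 1) (geomTorsion (W.baseChange K) (((3 : ℕ) : ℤ) ^ (k + 1)))))
    (hVdef : V = ((W.baseChange K).ordinaryFiltrationAt v t ht).twistedFil (m := m) (k + 1))
    (hV'def : V' = (((W.baseChange K).ordinaryFiltrationAt (σ • v) t ht).twistedFil (m := m) (k + 1)).map
      ((κ.eisensteinTwist ((W.baseChange K).torsionGaloisModule (((3 : ℕ) : ℤ) ^ (k + 1))) hm (k + 1))
        ((ConjugationDatum.ofLifts σ hσ₁ hσ τ hτ hτ₂).δ v)))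
    (hV : ∀ g : absoluteGaloisGroup (v.adicCompletion K), V ≤ V.comap
      (GaloisRep.toLocal v (κ.eisensteinTwist ((W.baseChange K).torsionGaloisModule (((3 : ℕ) : ℤ) ^ (k + 1))) hm (k + 1)) g))
    (hV' : ∀ g : absoluteGaloisGroup (v.adicCompletion K), V' ≤ V'.comap
      (GaloisRep.toLocal v ((ConjugationDatum.ofLifts σ hσ₁ hσ τ hτ hτ₂).twist
        (κ.eisensteinTwist ((W.baseChange K).torsionGaloisModule (((3 : ℕ) : ℤ) ^ (k + 1))) hm (k + 1))) g)) :
    ∃ P : ContPairing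
        ((GaloisRep.toLocal v (κ.eisensteinTwist ((W.baseChange K).torsionGaloisModule (((3 : ℕ) : ℤ) ^ (k + 1))) hm
          (k + 1))).subrepresentation V hV).toTopRep
        ((GaloisRep.toLocal v ((ConjugationDatum.ofLifts σ hσ₁ hσ τ hτ hτ₂).twist
          (κ.eisensteinTwist ((W.baseChange K).torsionGaloisModule (((3 : ℕ) : ℤ) ^ (k + 1))) hm (k + 1)))).quotient
          V' hV').toTopRep
        (GaloisRep.toLocal v D.twistOne).toTopRep,
      (∀ s (t : EisensteinCoeff.Twisted 3 m (k + 1) (geomTorsion (W.baseChange K) (((3 : ℕ) : ℤ) ^ (k + 1)))),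
          P.toLin s (Submodule.Quotient.mk t) = D.e (s : _) t) ∧
      (∀ y, (∀ x, P.cupProduct x y = 0) → y = 0) ∧ (∀ x, (∀ y, P.cupProduct x y = 0) → x = 0) := by
  haveI : NeZero (3 ^ (k + 1)) := ⟨pow_ne_zero _ Nat.prime_three.ne_zero⟩
  haveI : Finite (geomTorsion (W.baseChange K) (((3 : ℕ) : ℤ) ^ (k + 1))) :=
    finite_torsionPoints_holds (W.baseChange K) (AlgebraicClosure K)
      (pow_ne_zero _ (Nat.cast_ne_zero.mpr Nat.prime_three.ne_zero))
  haveI : Finite (EisensteinCoeff.Twisted 3 m (k + 1) (geomTorsion (W.baseChange K) (((3 : ℕ) : ℤ) ^ (k + 1)))) :=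
    EisensteinCoeff.finite_twisted hm
  -- the three module-level clauses for `E = eisensteinDualityForm hm (k+1) ẽ` on the spans
  have hclauses := W.eisensteinDualityForm_torsionFilAt_restricted_perfect_of_hasMultiplicativeReductionAt_three hm σ hσ₁ hσ τ
    hτ hτ₂ v hmult hpv (k + 1) e log hlog.1 halt hnd hθθ
  obtain ⟨horth, hR, hS⟩ := hclauses
  -- identify the submodules: `V` is the span (rfl) and `V′` is the span of the `δ_v`-translate
  have hVeq : V = Submodule.span ℤ {x | ∃ (c : EisensteinCoeff 3 m (k + 1))
      (a : geomTorsion (W.baseChange K) (((3 : ℕ) : ℤ) ^ (k + 1))),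
        a ∈ (W.baseChange K).torsionFilAt v (((3 : ℕ) : ℤ) ^ (k + 1)) ∧ x = EisensteinCoeff.Twisted.tmul c a} := hVdef
  have hV'eq : V' = Submodule.span ℤ {x | ∃ (c : EisensteinCoeff 3 m (k + 1))
      (b : geomTorsion (W.baseChange K) (((3 : ℕ) : ℤ) ^ (k + 1))),
        b ∈ ((W.baseChange K).torsionFilAt (σ • v) (((3 : ℕ) : ℤ) ^ (k + 1))).map
          ((W.baseChange K).torsionGaloisModule (((3 : ℕ) : ℤ) ^ (k + 1)) ((ConjugationDatum.ofLifts σ hσ₁ hσ τ hτ hτ₂).δ v)) ∧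
        x = EisensteinCoeff.Twisted.tmul c b} := by
    rw [hV'def]
    exact ZpExtension.map_eisensteinTwist_span_tmul κ ((W.baseChange K).torsionGaloisModule (((3 : ℕ) : ℤ) ^ (k + 1))) hm (k + 1)
      ((W.baseChange K).torsionFilAt (σ • v) (((3 : ℕ) : ℤ) ^ (k + 1))) ((ConjugationDatum.ofLifts σ hσ₁ hσ τ hτ hτ₂).δ v)
  have horth' : ∀ s ∈ V, ∀ t ∈ V', D.e s t = 0 := by
    intro s hs t ht
    rw [hVeq] at hs
    rw [hV'eq] at ht
    rw [hDe]
    exact horth s hs t ht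
  have hP0 := D.exists_restrictedPairing v V hV V' hV' horth'
  obtain ⟨P, hP⟩ := hP0
  -- the reading `λ = tailFormZMod`, `exp = log⁻¹`
  have hM : ∀ x : EisensteinCoeff.Twisted 3 m (k + 1) (geomTorsion (W.baseChange K) (((3 : ℕ) : ℤ) ^ (k + 1))),
      (3 ^ (k + 1)) • x = 0 := fun x ↦ EisensteinCoeff.prime_pow_nsmul_twisted x
  let lam : EisensteinCoeff 3 m (k + 1) →+ ZMod (3 ^ (k + 1)) := (EisensteinCoeff.tailFormZMod 3 hm (k + 1)).toAddMonoidHom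
  have hlam : ∀ (z : ℤ_[3]) (r : EisensteinCoeff 3 m (k + 1)),
      lam (algebraMap ℤ_[3] (EisensteinCoeff 3 m (k + 1)) z * r) = PadicInt.toZModPow (k + 1) z * lam r := by
    intro z r
    change EisensteinCoeff.tailFormZMod 3 hm (k + 1) _ = _ * EisensteinCoeff.tailFormZMod 3 hm (k + 1) r
    rw [EisensteinCoeff.algebraMap_padicInt_eq_ofZMod_toZModPow 3 hm (k + 1), EisensteinCoeff.tailFormZMod_ofZMod_mul]
  let E : MuCarrier K (3 ^ (k + 1)) ≃+ ZMod (3 ^ (k + 1)) := AddEquiv.ofBijective log hlog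
  let exp : ZMod (3 ^ (k + 1)) →+ MuCarrier K (3 ^ (k + 1)) := E.symm.toAddMonoidHom
  have hexp : ∀ (g : absoluteGaloisGroup K) (x : ZMod (3 ^ (k + 1))),
      exp (cyclotomicCharacterModPow K 3 (k + 1) g * x) = mu K (3 ^ (k + 1)) g (exp x) := by
    intro g x
    apply hlog.1
    have h1 : log (exp x) = x := E.apply_symm_apply x
    have h2 : log (exp (cyclotomicCharacterModPow K 3 (k + 1) g * x)) = cyclotomicCharacterModPow K 3 (k + 1) g * x :=
      E.apply_symm_apply _
    rw [hlogχ, h1, h2]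
  have hexpb : Bijective exp := E.symm.bijective
  have hR' : ∀ t, (∀ s ∈ V, lam (D.e s t) = 0) → t ∈ V' := by
    intro t ht
    rw [hV'eq]
    refine hR t fun s hs ↦ ?_
    have h := ht s (by rw [hVeq]; exact hs)
    rw [hDe] at h
    exact h
  have hS' : ∀ φ : V →+ ZMod (3 ^ (k + 1)), ∃ t, ∀ s : V, lam (D.e (s : _) t) = φ s := by
    subst hVeq
    intro φ
    obtain ⟨t, ht⟩ := hS φ
    refine ⟨t, fun s ↦ ?_⟩
    rw [hDe]
    exact ht s
  refine ⟨P, hP, fun y hy ↦ ?_, fun x hx ↦ ?_⟩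
  · exact DualityDatum.restrictedPairing_eq_zero_of_forall_cupProduct_eq_zero_right lam hlam exp hexp hexpb P hP hM hR' hS'
      y hy
  · exact DualityDatum.restrictedPairing_eq_zero_of_forall_cupProduct_eq_zero_left lam hlam exp hexp hexpb P hP hM hR' hS'
      x hx

end WeierstrassCurve

end
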